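import Literature.MathematicalPhysics.KineticTheory.HardSphereEulerClassicalUniqueness
import Literature.MathematicalPhysics.KineticTheory.HardSphereEulerFrozenEnergyIdentity
import Literature.MathematicalPhysics.KineticTheory.HardSphereEulerEnergyShell
import Literature.MathematicalPhysics.KineticTheory.HardSphereEulerUniformCoefficients
import Literature.Analysis.FunctionSpaces.TorusEnstrophyOrthogonality
import Literature.Analysis.FunctionSpaces.TorusDiffMonomialBounds
import Literature.Analysis.FluidPDE.MVRelativeEnergyPointwiseBounds
import HarnessLib

/-!
# Level-0 relative-energy stability between a hard-sphere Euler solution and an ideal-gas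
# reference, with constants uniform in the reduced diameter

MathematicalPhysics/KineticTheory proof file (theorems only; no definitions, no named facts), part
of LAYER 4 (the fixed-horizon a-priori stability estimate, T. Kato, ARMA 58 (1975) §§3–4 /
A. Majda 1984, Ch. 2, proof of Thms 2.1–2.2) of the proof of `hsEuler_continuousDependence`
(`HardSphereEulerContinuousDependenceProofs.lean`). A classical solution `V = (ρ, u, θ)` of the
hard-sphere Euler system at reduced diameter `σ` (pressure `ρθZ(ρσ³)`, `Z = hsCompressibility`
analytic at small packing under the equation-of-state hypothesis of `hsEuler_localExistence`) is
compared with a classical IDEAL-GAS solution `V₁ = (ρ₁, u₁, θ₁)` (`σ = 0`, pressure `ρ₁θ₁`) on a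
common interval `[0, T)`, in the symmetrised `L²` (level-0) relative energy
`E = ∫ ½ (A δρ² + ρ ‖δu‖² + B δθ²)`, `A = θ(Z + ηZ′)(ρσ³)/ρ`, `B = 3ρ/(2θ)`:

* `HsEulerStability.twoEos_rhs_alg_le` (§1, pure algebra) — the right-hand side of the pointwise
  balance `HsEulerStability.hsEuler_relativeEnergy_balance_two_eos`
  (`HardSphereEulerFrozenEnergyIdentity.lean`) is absorbed: with all zero-order quantities and
  first derivatives of both solutions bounded by `P ≥ 1` and the equation-of-state defects
  `|ζ - 1|, |ζ + ρζ′ - 1| ≤ D` it is `≤ 100 P⁶ (δρ² + δθ² + Σⱼ δuⱼ²) + 10 P⁴ D (|δθ| + Σⱼ |δuⱼ|)`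
  (summands `S1`–`S7`; the defect of the weight `A` splits into an `O(D)` and an `O(δρ, δθ)`
  part, `twoEos_alg_S6_summand`);
* `HsEulerStability.exists_bound_Z_derivs`, `abs_Z_sub_Z_zero_le` (§2) — bounds of `Z, Z′, Z″`
  on `[0, η_c]` and the mean-value bound `|Z(η) - 1| ≤ Z_B η` (the defects are `O(ρσ³)`);
* `hsEuler_twoEos_level0_stability` (§3) — **the estimate**: for state bound `M` and derivative
  bound `Λ` there are `ηQ > 0` and `K₁, K₂, K₃ ≥ 0`, chosen BEFORE `σ`, with
  `∫ (δρ² + ‖δu‖² + δθ²)(t) ≤ K₁ e^{K₂t} (∫ (δρ² + ‖δu‖² + δθ²)(0) + K₃ (σ³t)²)` for every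
  `0 < σ ≤ 1`, every pair of solutions with `M⁻¹ ≤ ρ, θ, ρ₁, θ₁ ≤ M`, packing `ρσ³ ≤ ηQ` and
  first derivatives `≤ Λ`, and every `t ∈ [0, T)`. Proof: coercivity `E ≥ (δρ² + ‖δu‖² + δθ²)/(4M²)`
  (`Z + ηZ′ ∈ [1/2, 3/2]` at small packing, `HsEulerUniform.exists_eos_family`), the remainder
  `r = ∂ₜe + Σᵢ∂ᵢΦᵢ - Λ₀ e` with `∫ r ≤ C_g σ³ √E` (Cauchy–Schwarz on the probability space `𝕋³`),
  and the Grönwall shell `HsEulerCalc.torus_energy_le_of_balance` (`HardSphereEulerEnergyShell.lean`).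

This is the `L²`-smallness input of the bootstrap proving the stability estimate (sequel file);
no energy of DERIVATIVES of the difference is needed there, because the reference is `C^∞`.

## Mathlib / tree search

Tree: `hsEuler_relativeEnergy_balance_two_eos`, `isSmoothSpaceTimeOn_frozenEnergy/Flux`
(`HardSphereEulerFrozenEnergyIdentity`), `HsEulerCalc.torus_energy_le_of_balance`
(`HardSphereEulerEnergyShell`), `HsEulerCalc.energy_alg_ge`, `abs_sum_mul_mul_le`
(`HardSphereEulerClassicalUniqueness`), `CompressibleEuler.abs_mul_le_of_le` (`MVRelativeEnergyPointwiseBounds`), `HsEulerUniform.exists_eos_family`, `deriv_rescale`,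
`hsPressure_eq_of_eqOn` (`HardSphereEulerUniformCoefficients`), `Torus.partialDeriv_apply_coord`
(`TorusEnstrophyOrthogonality`), `Torus.integral_mul_le_sqrt_mul_sqrt` (`TorusDiffMonomialBounds`),
`Torus.IsSmoothSpaceTimeOn.{sub, mul, add, sum, partialDeriv, timeDerivWithin, isSmooth_slice}`.
Mathlib: `Convex.norm_image_sub_le_of_norm_hasDerivWithin_le`, `contDiff_infty_iff_deriv`,
`IsCompact.exists_bound_of_continuousOn`, `integral_mono`, `integral_const_mul`,
`EuclideanSpace.real_norm_sq_eq`, `Real.sq_sqrt`, `intervalIntegral.integral_const`.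

## References

* T. Kato, *The Cauchy problem for quasi-linear symmetric hyperbolic systems*, Arch. Rational
  Mech. Anal. 58 (1975) 181–205, §§3–4 and Thm III. [`Kato1975`]
* A. Majda, *Compressible Fluid Flow and Systems of Conservation Laws in Several Space
  Variables*, Appl. Math. Sci. 53, Springer 1984: Ch. 2, §2.1, proof of Thms 2.1–2.2 (the
  symmetrised energy estimate for the difference of two solutions). [`Majda1984`]
* C. M. Dafermos, *Hyperbolic Conservation Laws in Continuum Physics*, 2nd ed. (2005), Ch. V,
  Thm 5.2.1 (relative energy / `L²` stability of classical solutions). [`Dafermos2005`]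
-/

noncomputable section

open Set Filter MeasureTheory
open scoped ContDiff

namespace Literature.MathematicalPhysics.KineticTheory

namespace HsEulerStability

open HsEulerCalc Literature.Analysis.FunctionSpaces
open Literature.Analysis.FluidPDE.CompressibleEuler (abs_mul_le_of_le)

/-! ## §1 Pointwise absorption of the two-equation-of-state remainder (pure algebra) -/

section Algebra

/-- `|∑ᵢ f i| ≤ 3 K` on `Fin 3` from `|f i| ≤ K`. [folklore] -/
theorem abs_sum_fin_three_le {f : Fin 3 → ℝ} {K : ℝ} (h : ∀ i, |f i| ≤ K) : |∑ i, f i| ≤ 3 * K := by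
  calc |∑ i, f i| ≤ ∑ i, |f i| := Finset.abs_sum_le_sum_abs _ _
    _ ≤ ∑ _i : Fin 3, K := Finset.sum_le_sum fun i _ => h i
    _ = 3 * K := by simp

/-- A coefficient bounded by `K` against a square: `c a² ≤ K a²`. [folklore] -/
theorem mul_sq_le_of_abs_le {c K a : ℝ} (h : |c| ≤ K) : c * a ^ 2 ≤ K * a ^ 2 :=
  (le_abs_self _).trans (by rw [abs_mul, abs_pow, sq_abs]; exact mul_le_mul_of_nonneg_right h (sq_nonneg _))

/-- A coefficient bounded by `K` against a product with a small factor `|d| ≤ D`: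
`c d a ≤ K D |a|`. [folklore] -/
theorem mul_mul_le_of_abs_le {c d a K D : ℝ} (hc : |c| ≤ K) (hd : |d| ≤ D) : c * d * a ≤ K * D * |a| := by
  have hK : 0 ≤ K := (abs_nonneg _).trans hc
  have hD : 0 ≤ D := (abs_nonneg _).trans hd
  calc c * d * a ≤ |c * d * a| := le_abs_self _
    _ = |c| * |d| * |a| := by rw [abs_mul, abs_mul]
    _ ≤ K * D * |a| := mul_le_mul (mul_le_mul hc hd (abs_nonneg _) hK) le_rfl (abs_nonneg _) (mul_nonneg hK hD)

/-- A coefficient bounded by `K` against a product of two small quantities: `c a b ≤ K (a² + b²)`.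
[folklore] -/
theorem mul_mul_le_sq_add_sq {c a b K : ℝ} (hc : |c| ≤ K) : c * a * b ≤ K * (a ^ 2 + b ^ 2) := by
  have h := abs_sum_mul_mul_le ({(0 : Fin 1)} : Finset (Fin 1)) (c := fun _ => c) (a := fun _ => a)
    (b := fun _ => b) (K := K) fun _ _ => hc
  simp only [Finset.sum_singleton] at h
  exact (le_abs_self _).trans h

/-- `Σₖ cₖ a bₖ ≤ K (3a² + Σₖ bₖ²)` on `Fin 3` when `|cₖ| ≤ K`. [folklore] -/
theorem sum_mul_mul_le_fin_three {c b : Fin 3 → ℝ} {a K : ℝ} (hc : ∀ k, |c k| ≤ K) :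
    ∑ k, c k * a * b k ≤ K * (3 * a ^ 2 + ∑ k, b k ^ 2) := by
  have h := abs_sum_mul_mul_le (Finset.univ : Finset (Fin 3)) (c := c) (a := fun _ => a) (b := b)
    (K := K) fun k _ => hc k
  have h' := (le_abs_self _).trans h
  have hs : ∑ k : Fin 3, (a ^ 2 + b k ^ 2) = 3 * a ^ 2 + ∑ k, b k ^ 2 := by
    simp only [Finset.sum_add_distrib, Finset.sum_const, Finset.card_univ, Fintype.card_fin, nsmul_eq_mul,
      Nat.cast_ofNat]
  rwa [hs] at h'

/-- Summand `j` of the velocity-equation part of the two-equation-of-state remainder (the term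
`S6` below), after multiplication by the weight `ρ = r`: with `|g - 1|, |z - 1| ≤ D` and all atoms
bounded by `P ≥ 1`,
`-r wⱼ (Σᵢ wᵢ ∂ᵢu₁ⱼ + (th g/r - th₁/r₁) ∂ⱼρ₁ + (z-1) ∂ⱼθ₁) ≤ P²(3wⱼ² + Σ wᵢ²) + 2P² D |wⱼ| + P((th-th₁)² + wⱼ²) + P³((r-r₁)² + wⱼ²)`.
[folklore] -/
theorem twoEos_alg_S6_summand {P D th r th₁ r₁ g z : ℝ} {du₁ : Fin 3 → Fin 3 → ℝ} {dρ₁ dθ₁ w : Fin 3 → ℝ}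
    (hP : 1 ≤ P) (hth : |th| ≤ P) (hr : |r| ≤ P) (hth₁ : |th₁| ≤ P) (hr₁i : |r₁⁻¹| ≤ P) (hr0 : r ≠ 0)
    (hr₁0 : r₁ ≠ 0) (hdu₁ : ∀ i j, |du₁ i j| ≤ P) (hdρ₁ : ∀ i, |dρ₁ i| ≤ P) (hdθ₁ : ∀ i, |dθ₁ i| ≤ P)
    (hdz : |z - 1| ≤ D) (hdg : |g - 1| ≤ D) (j : Fin 3) :
    r * (w j * -(∑ i, w i * du₁ i j + (th * g / r - th₁ * (1 + r₁ * 0) / r₁) * dρ₁ j + (z - 1) * dθ₁ j)) ≤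
      P ^ 2 * (3 * w j ^ 2 + ∑ i, w i ^ 2) + 2 * P ^ 2 * D * |w j| + P * ((th - th₁) ^ 2 + w j ^ 2) +
        P ^ 3 * ((r - r₁) ^ 2 + w j ^ 2) := by
  have hP0 : 0 ≤ P := zero_le_one.trans hP
  have hP12 : P ≤ P ^ 2 := by simpa using pow_le_pow_right₀ hP (show 1 ≤ 2 by norm_num)
  -- the defect of the weight `A` splits into an `O(D)` part and an `O(α, β)` part
  have hsplit : r * (w j * -(∑ i, w i * du₁ i j + (th * g / r - th₁ * (1 + r₁ * 0) / r₁) * dρ₁ j +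
      (z - 1) * dθ₁ j)) =
      -(∑ i, (r * du₁ i j) * w j * w i) + (-(th * dρ₁ j)) * (g - 1) * w j + (-dρ₁ j) * (th - th₁) * w j +
        (th₁ * dρ₁ j * r₁⁻¹) * (r - r₁) * w j + (-(r * dθ₁ j)) * (z - 1) * w j := by
    have h1 : ∑ i, r * du₁ i j * w j * w i = r * w j * ∑ i, w i * du₁ i j := by
      rw [Finset.mul_sum]
      exact Finset.sum_congr rfl fun i _ => by ring
    rw [h1]
    field_simp
    ring
  rw [hsplit]
  have t1 : -(∑ i, (r * du₁ i j) * w j * w i) ≤ P ^ 2 * (3 * w j ^ 2 + ∑ i, w i ^ 2) := by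
    have hc : ∀ i, |-(r * du₁ i j)| ≤ P ^ 2 := fun i => by
      rw [abs_neg]; have h := abs_mul_le_of_le hr (hdu₁ i j); nlinarith [h]
    have h := sum_mul_mul_le_fin_three (a := w j) (b := w) hc
    have heq : ∑ k, -(r * du₁ k j) * w j * w k = -∑ i, r * du₁ i j * w j * w i := by
      rw [← Finset.sum_neg_distrib]; exact Finset.sum_congr rfl fun k _ => by ring
    linarith
  have t2 : (-(th * dρ₁ j)) * (g - 1) * w j ≤ P ^ 2 * D * |w j| :=
    mul_mul_le_of_abs_le (by rw [abs_neg]; have h := abs_mul_le_of_le hth (hdρ₁ j); nlinarith [h]) hdg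
  have t3 : (-dρ₁ j) * (th - th₁) * w j ≤ P * ((th - th₁) ^ 2 + w j ^ 2) :=
    mul_mul_le_sq_add_sq (by rw [abs_neg]; exact hdρ₁ j)
  have t4 : (th₁ * dρ₁ j * r₁⁻¹) * (r - r₁) * w j ≤ P ^ 3 * ((r - r₁) ^ 2 + w j ^ 2) :=
    mul_mul_le_sq_add_sq (by
      have h := abs_mul_le_of_le (abs_mul_le_of_le hth₁ (hdρ₁ j)) hr₁i
      have heq : P * P * P = P ^ 3 := by ring
      linarith)
  have t5 : (-(r * dθ₁ j)) * (z - 1) * w j ≤ P ^ 2 * D * |w j| :=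
    mul_mul_le_of_abs_le (by rw [abs_neg]; have h := abs_mul_le_of_le hr (hdθ₁ j); nlinarith [h]) hdz
  linarith

/-- The velocity-equation part `S6` of the two-equation-of-state remainder, summed:
`≤ 6P⁶ Σwⱼ² + 2P²D Σ|wⱼ| + P(3(th-th₁)² + Σwⱼ²) + P³(3(r-r₁)² + Σwⱼ²)`. [folklore] -/
theorem twoEos_alg_S6 {P D th r th₁ r₁ g z : ℝ} {du₁ : Fin 3 → Fin 3 → ℝ} {dρ₁ dθ₁ w : Fin 3 → ℝ}
    (hP : 1 ≤ P) (hth : |th| ≤ P) (hr : |r| ≤ P) (hth₁ : |th₁| ≤ P) (hr₁i : |r₁⁻¹| ≤ P) (hr0 : r ≠ 0)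
    (hr₁0 : r₁ ≠ 0) (hdu₁ : ∀ i j, |du₁ i j| ≤ P) (hdρ₁ : ∀ i, |dρ₁ i| ≤ P) (hdθ₁ : ∀ i, |dθ₁ i| ≤ P)
    (hdz : |z - 1| ≤ D) (hdg : |g - 1| ≤ D) :
    r * ∑ j, w j * -(∑ i, w i * du₁ i j + (th * g / r - th₁ * (1 + r₁ * 0) / r₁) * dρ₁ j + (z - 1) * dθ₁ j) ≤
      6 * P ^ 2 * (∑ k, w k ^ 2) + 2 * P ^ 2 * D * (∑ k, |w k|) + P * (3 * (th - th₁) ^ 2 + ∑ k, w k ^ 2) +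
        P ^ 3 * (3 * (r - r₁) ^ 2 + ∑ k, w k ^ 2) := by
  rw [Finset.mul_sum]
  have h := Finset.sum_le_sum fun j (_ : j ∈ (Finset.univ : Finset (Fin 3))) =>
    twoEos_alg_S6_summand (w := w) hP hth hr hth₁ hr₁i hr0 hr₁0 hdu₁ hdρ₁ hdθ₁ hdz hdg j
  refine h.trans (le_of_eq ?_)
  simp only [Fin.sum_univ_three]
  ring

/-- The temperature-equation part `S7` of the two-equation-of-state remainder:
`B (th-th₁) (-(Σ wᵢ∂ᵢθ₁ + (2/3)(th z - th₁) div u₁)) ≤ (3/2)P³(3(th-th₁)² + Σwᵢ²) + 3P⁴D|th-th₁| + 3P³(th-th₁)²`.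
[folklore] -/
theorem twoEos_alg_S7 {P D th r th₁ z : ℝ} {du₁ : Fin 3 → Fin 3 → ℝ} {dθ₁ w : Fin 3 → ℝ}
    (hP : 1 ≤ P) (hth : |th| ≤ P) (hB : |3 / 2 * r / th| ≤ 3 / 2 * P ^ 2)
    (hdv₁b : |∑ i, du₁ i i| ≤ 3 * P) (hdθ₁ : ∀ i, |dθ₁ i| ≤ P) (hdz : |z - 1| ≤ D) :
    3 / 2 * r / th * (th - th₁) * -(∑ i, w i * dθ₁ i + 2 / 3 * (th * z - th₁ * 1) * ∑ i, du₁ i i) ≤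
      3 / 2 * P ^ 3 * (3 * (th - th₁) ^ 2 + ∑ k, w k ^ 2) + 3 * P ^ 4 * D * |th - th₁| +
        3 * P ^ 3 * (th - th₁) ^ 2 := by
  have hP0 : 0 ≤ P := zero_le_one.trans hP
  set be := th - th₁ with hbe
  set dv₁ := ∑ i, du₁ i i with hdv₁
  have hsplit : 3 / 2 * r / th * be * -(∑ i, w i * dθ₁ i + 2 / 3 * (th * z - th₁ * 1) * dv₁) =
      (∑ i, (-(3 / 2 * r / th * dθ₁ i)) * be * w i) +
        (-(2 / 3 * (3 / 2 * r / th) * dv₁ * th)) * (z - 1) * be + (-(2 / 3 * (3 / 2 * r / th) * dv₁)) * be ^ 2 := by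
    have h0 : th * z - th₁ * 1 = th * (z - 1) + be := by rw [hbe]; ring
    have h1 : 3 / 2 * r / th * be * ∑ i, w i * dθ₁ i = ∑ i, 3 / 2 * r / th * dθ₁ i * be * w i := by
      rw [Finset.mul_sum]; exact Finset.sum_congr rfl fun i _ => by ring
    have h2 : ∑ i, (-(3 / 2 * r / th * dθ₁ i)) * be * w i = -∑ i, 3 / 2 * r / th * dθ₁ i * be * w i := by
      rw [← Finset.sum_neg_distrib]; exact Finset.sum_congr rfl fun i _ => by ring
    rw [h0, h2, ← h1]
    ring
  rw [hsplit]
  have h23 : |2 / 3 * (3 / 2 * r / th)| ≤ 2 / 3 * (3 / 2 * P ^ 2) := by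
    rw [abs_mul, abs_of_pos (by norm_num : (0:ℝ) < 2 / 3)]; linarith
  refine add_le_add (add_le_add (sum_mul_mul_le_fin_three fun k => ?_) ?_) (mul_sq_le_of_abs_le ?_)
  · rw [abs_neg]
    have h := abs_mul_le_of_le hB (hdθ₁ k)
    have heq : 3 / 2 * P ^ 2 * P = 3 / 2 * P ^ 3 := by ring
    linarith
  · refine mul_mul_le_of_abs_le ?_ hdz
    rw [abs_neg]
    have h := abs_mul_le_of_le (abs_mul_le_of_le h23 hdv₁b) hth
    have heq : 2 / 3 * (3 / 2 * P ^ 2) * (3 * P) * P = 3 * P ^ 4 := by ring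
    linarith
  · rw [abs_neg]
    have h := abs_mul_le_of_le h23 hdv₁b
    have heq : 2 / 3 * (3 / 2 * P ^ 2) * (3 * P) = 3 * P ^ 3 := by ring
    linarith

/-- **The two-equation-of-state remainder is absorbed pointwise** (pure algebra in the point values
of the fields). With all zero-order quantities and first derivatives bounded by `P ≥ 1` and the
equation-of-state defects `|ζ - 1|, |ζ + ρζ' - 1| ≤ D`, the right-hand side of
`hsEuler_relativeEnergy_balance_two_eos` (reference law `ζ₂ ≡ 1`) is at most
`100 P⁶ (α² + β² + Σ wⱼ²) + 10 P⁴ D (|β| + Σ |wⱼ|)`. [folklore] -/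
theorem twoEos_rhs_alg_le {P D th r th₁ r₁ z z1 z2 z₂v z₂d : ℝ} {du du₁ : Fin 3 → Fin 3 → ℝ}
    {dρ dθ dρ₁ dθ₁ w : Fin 3 → ℝ} (hP : 1 ≤ P)
    (hth : |th| ≤ P) (hr : |r| ≤ P) (hri : |r⁻¹| ≤ P) (hthi : |th⁻¹| ≤ P) (hth₁ : |th₁| ≤ P)
    (hr₁i : |r₁⁻¹| ≤ P) (hr0 : r ≠ 0) (hr₁0 : r₁ ≠ 0)
    (hz : |z| ≤ P) (hz1 : |z1| ≤ P) (hz2 : |z2| ≤ P)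
    (hdu : ∀ i j, |du i j| ≤ P) (hdρ : ∀ i, |dρ i| ≤ P) (hdθ : ∀ i, |dθ i| ≤ P)
    (hdu₁ : ∀ i j, |du₁ i j| ≤ P) (hdρ₁ : ∀ i, |dρ₁ i| ≤ P) (hdθ₁ : ∀ i, |dθ₁ i| ≤ P)
    (hdz : |z - 1| ≤ D) (hdg : |z + r * z1 - 1| ≤ D) (hz₂v : z₂v = 1) (hz₂d : z₂d = 0) :
    1 / 2 * ((th * (z + r * z1) / r * (2 - 2 / 3 * z) - th * (2 * z1 + r * z2)) * ∑ i, du i i) * (r - r₁) ^ 2 +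
      1 / 2 * (2 / 3 * z * (3 / 2 * r / th) * ∑ i, du i i) * (th - th₁) ^ 2 +
      (∑ i, (dθ i * (z + r * z1) + th * (2 * z1 + r * z2) * dρ i) * (r - r₁) * w i) +
      (∑ i, (z + r * z1) * dρ i * (th - th₁) * w i) +
      th * (z + r * z1) / r * (r - r₁) * -((r - r₁) * ∑ i, du₁ i i + ∑ i, w i * dρ₁ i) +
      r * ∑ j, w j * -(∑ i, w i * du₁ i j +
          (th * (z + r * z1) / r - th₁ * (z₂v + r₁ * z₂d) / r₁) * dρ₁ j + (z - z₂v) * dθ₁ j) +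
      3 / 2 * r / th * (th - th₁) * -(∑ i, w i * dθ₁ i + 2 / 3 * (th * z - th₁ * z₂v) * ∑ i, du₁ i i) ≤
    100 * P ^ 6 * ((r - r₁) ^ 2 + (th - th₁) ^ 2 + ∑ j, w j ^ 2) +
      10 * P ^ 4 * D * (|th - th₁| + ∑ j, |w j|) := by
  subst hz₂v hz₂d
  have hP0 : 0 ≤ P := zero_le_one.trans hP
  have hD : 0 ≤ D := (abs_nonneg _).trans hdz
  have hP16 : P ≤ P ^ 6 := by simpa using pow_le_pow_right₀ hP (show 1 ≤ 6 by norm_num)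
  have hP26 : P ^ 2 ≤ P ^ 6 := pow_le_pow_right₀ hP (by norm_num)
  have hP36 : P ^ 3 ≤ P ^ 6 := pow_le_pow_right₀ hP (by norm_num)
  have hP46 : P ^ 4 ≤ P ^ 6 := pow_le_pow_right₀ hP (by norm_num)
  have hP56 : P ^ 5 ≤ P ^ 6 := pow_le_pow_right₀ hP (by norm_num)
  have hP12 : P ≤ P ^ 2 := by simpa using pow_le_pow_right₀ hP (show 1 ≤ 2 by norm_num)
  have hP24 : P ^ 2 ≤ P ^ 4 := pow_le_pow_right₀ hP (by norm_num)
  -- bounds for the derived atoms (each as a monomial in `P`)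
  have hB : |3 / 2 * r / th| ≤ 3 / 2 * P ^ 2 := by
    rw [div_eq_mul_inv]
    have h := abs_mul_le_of_le (abs_mul_le_of_le (abs_of_pos (by norm_num : (0:ℝ) < 3 / 2)).le hr) hthi
    have heq : 3 / 2 * P * P = 3 / 2 * P ^ 2 := by ring
    linarith only [h, heq]
  have hdvb : |∑ i, du i i| ≤ 3 * P := abs_sum_fin_three_le fun i => hdu i i
  have hdv₁b : |∑ i, du₁ i i| ≤ 3 * P := abs_sum_fin_three_le fun i => hdu₁ i i
  have hgb : |z + r * z1| ≤ 2 * P ^ 2 := by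
    have h1 : |r * z1| ≤ P * P := abs_mul_le_of_le hr hz1
    have h2 : |z + r * z1| ≤ |z| + |r * z1| := abs_add_le _ _
    have heq : P * P = P ^ 2 := by ring
    linarith only [h1, h2, heq, hz, hP12]
  have hA : |th * (z + r * z1) / r| ≤ 2 * P ^ 4 := by
    rw [div_eq_mul_inv]
    have h := abs_mul_le_of_le (abs_mul_le_of_le hth hgb) hri
    have heq : P * (2 * P ^ 2) * P = 2 * P ^ 4 := by ring
    linarith only [h, heq]
  have hhb : |2 * z1 + r * z2| ≤ 3 * P ^ 2 := by
    have h1 : |2 * z1| ≤ 2 * P := by rw [abs_mul, abs_two]; linarith only [hz1]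
    have h2 : |r * z2| ≤ P * P := abs_mul_le_of_le hr hz2
    have h3 : |2 * z1 + r * z2| ≤ |2 * z1| + |r * z2| := abs_add_le _ _
    have heq : P * P = P ^ 2 := by ring
    linarith only [h1, h2, h3, heq, hP12]
  have hthh : |th * (2 * z1 + r * z2)| ≤ 3 * P ^ 3 := by
    have h := abs_mul_le_of_le hth hhb
    have heq : P * (3 * P ^ 2) = 3 * P ^ 3 := by ring
    linarith only [h, heq]
  -- S1
  have e1 : 1 / 2 * ((th * (z + r * z1) / r * (2 - 2 / 3 * z) - th * (2 * z1 + r * z2)) * ∑ i, du i i) *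
      (r - r₁) ^ 2 ≤ 14 * P ^ 6 * (r - r₁) ^ 2 := by
    refine mul_sq_le_of_abs_le ?_
    have h2z : |2 - 2 / 3 * z| ≤ 3 * P := by
      have h1 : |2 - 2 / 3 * z| ≤ |(2:ℝ)| + |2 / 3 * z| := abs_sub _ _
      rw [abs_two, abs_mul, abs_of_pos (by norm_num : (0:ℝ) < 2 / 3)] at h1
      linarith only [h1, hz, hP]
    have hA2 : |th * (z + r * z1) / r * (2 - 2 / 3 * z)| ≤ 2 * P ^ 4 * (3 * P) := abs_mul_le_of_le hA h2z
    have hdiff : |th * (z + r * z1) / r * (2 - 2 / 3 * z) - th * (2 * z1 + r * z2)| ≤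
        2 * P ^ 4 * (3 * P) + 3 * P ^ 3 := (abs_sub _ _).trans (add_le_add hA2 hthh)
    have hprod := abs_mul_le_of_le hdiff hdvb
    have heq : (2 * P ^ 4 * (3 * P) + 3 * P ^ 3) * (3 * P) = 18 * P ^ 6 + 9 * P ^ 4 := by ring
    rw [abs_mul, abs_of_pos (by norm_num : (0:ℝ) < 1 / 2)]
    linarith only [hprod, heq, hP46, hP, hP16]
  -- S2
  have e2 : 1 / 2 * (2 / 3 * z * (3 / 2 * r / th) * ∑ i, du i i) * (th - th₁) ^ 2 ≤ 2 * P ^ 6 * (th - th₁) ^ 2 := by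
    refine mul_sq_le_of_abs_le ?_
    have h1 : |2 / 3 * z| ≤ 2 / 3 * P := by
      rw [abs_mul, abs_of_pos (by norm_num : (0:ℝ) < 2 / 3)]; linarith only [hz]
    have h2 := abs_mul_le_of_le (abs_mul_le_of_le h1 hB) hdvb
    have heq : 2 / 3 * P * (3 / 2 * P ^ 2) * (3 * P) = 3 * P ^ 4 := by ring
    rw [abs_mul, abs_of_pos (by norm_num : (0:ℝ) < 1 / 2)]
    linarith only [h2, heq, hP46, hP, hP16]
  -- S3
  have e3 : ∑ i, (dθ i * (z + r * z1) + th * (2 * z1 + r * z2) * dρ i) * (r - r₁) * w i ≤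
      5 * P ^ 6 * (3 * (r - r₁) ^ 2 + ∑ k, w k ^ 2) := by
    refine sum_mul_mul_le_fin_three fun k => ?_
    have h1 := abs_mul_le_of_le (hdθ k) hgb
    have h2 := abs_mul_le_of_le hthh (hdρ k)
    have h3 : |dθ k * (z + r * z1) + th * (2 * z1 + r * z2) * dρ k| ≤ P * (2 * P ^ 2) + 3 * P ^ 3 * P :=
      (abs_add_le _ _).trans (add_le_add h1 h2)
    have heq : P * (2 * P ^ 2) + 3 * P ^ 3 * P = 2 * P ^ 3 + 3 * P ^ 4 := by ring
    linarith only [h3, heq, hP36, hP46, hP, hP16]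
  -- S4
  have e4 : ∑ i, (z + r * z1) * dρ i * (th - th₁) * w i ≤ 2 * P ^ 6 * (3 * (th - th₁) ^ 2 + ∑ k, w k ^ 2) := by
    refine sum_mul_mul_le_fin_three fun k => ?_
    have h1 := abs_mul_le_of_le hgb (hdρ k)
    have heq : 2 * P ^ 2 * P = 2 * P ^ 3 := by ring
    linarith only [h1, heq, hP36, hP, hP16]
  -- S5
  have e5 : th * (z + r * z1) / r * (r - r₁) * -((r - r₁) * ∑ i, du₁ i i + ∑ i, w i * dρ₁ i) ≤
      6 * P ^ 6 * (r - r₁) ^ 2 + 2 * P ^ 6 * (3 * (r - r₁) ^ 2 + ∑ k, w k ^ 2) := by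
    have hsplit : th * (z + r * z1) / r * (r - r₁) * -((r - r₁) * ∑ i, du₁ i i + ∑ i, w i * dρ₁ i) =
        -(th * (z + r * z1) / r * ∑ i, du₁ i i) * (r - r₁) ^ 2 +
          ∑ i, (-(th * (z + r * z1) / r * dρ₁ i)) * (r - r₁) * w i := by
      have h1 : th * (z + r * z1) / r * (r - r₁) * ∑ i, w i * dρ₁ i =
          ∑ i, th * (z + r * z1) / r * dρ₁ i * (r - r₁) * w i := by
        rw [Finset.mul_sum]; exact Finset.sum_congr rfl fun i _ => by ring
      have h2 : ∑ i, (-(th * (z + r * z1) / r * dρ₁ i)) * (r - r₁) * w i =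
          -∑ i, th * (z + r * z1) / r * dρ₁ i * (r - r₁) * w i := by
        rw [← Finset.sum_neg_distrib]; exact Finset.sum_congr rfl fun i _ => by ring
      rw [h2, ← h1]
      ring
    rw [hsplit]
    refine add_le_add (mul_sq_le_of_abs_le ?_) (sum_mul_mul_le_fin_three fun k => ?_)
    · rw [abs_neg]
      have h := abs_mul_le_of_le hA hdv₁b
      have heq : 2 * P ^ 4 * (3 * P) = 6 * P ^ 5 := by ring
      linarith only [h, heq, hP56, hP, hP16]
    · rw [abs_neg]
      have h := abs_mul_le_of_le hA (hdρ₁ k)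
      have heq : 2 * P ^ 4 * P = 2 * P ^ 5 := by ring
      linarith only [h, heq, hP56, hP, hP16]
  -- S6, S7
  have e6 := twoEos_alg_S6 (w := w) hP hth hr hth₁ hr₁i hr0 hr₁0 hdu₁ hdρ₁ hdθ₁ hdz hdg
  have e7 := twoEos_alg_S7 (w := w) (th₁ := th₁) hP hth hB hdv₁b hdθ₁ hdz
  -- collect
  have hw0 : 0 ≤ ∑ k, w k ^ 2 := Finset.sum_nonneg fun k _ => sq_nonneg _
  have hw1 : 0 ≤ ∑ k, |w k| := Finset.sum_nonneg fun k _ => abs_nonneg _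
  have hal0 : 0 ≤ (r - r₁) ^ 2 := sq_nonneg _
  have hbe0 : 0 ≤ (th - th₁) ^ 2 := sq_nonneg _
  have hbe1 : 0 ≤ |th - th₁| := abs_nonneg _
  have q1 : P ^ 2 * (∑ k, w k ^ 2) ≤ P ^ 6 * (∑ k, w k ^ 2) := mul_le_mul_of_nonneg_right hP26 hw0
  have q2 : P * (th - th₁) ^ 2 ≤ P ^ 6 * (th - th₁) ^ 2 := mul_le_mul_of_nonneg_right hP16 hbe0
  have q3 : P * (∑ k, w k ^ 2) ≤ P ^ 6 * (∑ k, w k ^ 2) := mul_le_mul_of_nonneg_right hP16 hw0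
  have q4 : P ^ 3 * (r - r₁) ^ 2 ≤ P ^ 6 * (r - r₁) ^ 2 := mul_le_mul_of_nonneg_right hP36 hal0
  have q5 : P ^ 3 * (∑ k, w k ^ 2) ≤ P ^ 6 * (∑ k, w k ^ 2) := mul_le_mul_of_nonneg_right hP36 hw0
  have q6 : P ^ 3 * (th - th₁) ^ 2 ≤ P ^ 6 * (th - th₁) ^ 2 := mul_le_mul_of_nonneg_right hP36 hbe0
  have q7 : P ^ 2 * D * (∑ k, |w k|) ≤ P ^ 4 * D * (∑ k, |w k|) :=
    mul_le_mul_of_nonneg_right (mul_le_mul_of_nonneg_right hP24 hD) hw1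
  have q8 : 0 ≤ P ^ 6 * (r - r₁) ^ 2 := by positivity
  have q9 : 0 ≤ P ^ 6 * (th - th₁) ^ 2 := by positivity
  have q10 : 0 ≤ P ^ 6 * (∑ k, w k ^ 2) := by positivity
  have q11 : 0 ≤ P ^ 4 * D * |th - th₁| := by positivity
  have q12 : 0 ≤ P ^ 4 * D * (∑ k, |w k|) := by positivity
  linarith only [e1, e2, e3, e4, e5, e6, e7, q1, q2, q3, q4, q5, q6, q7, q8, q9, q10, q11, q12]

end Algebra

/-! ## §2 Real-variable facts about the smooth equation of state -/

section RealVariable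

/-- Bounds of a smooth `Z` and its first two derivatives on `[0, η_c]`, by one constant `≥ 1`.
[folklore] -/
theorem exists_bound_Z_derivs {Z : ℝ → ℝ} (hZ : ContDiff ℝ ∞ Z) (ηc : ℝ) :
    ∃ ZB : ℝ, 1 ≤ ZB ∧ ∀ η ∈ Icc 0 ηc, |Z η| ≤ ZB ∧ |deriv Z η| ≤ ZB ∧ |deriv (deriv Z) η| ≤ ZB := by
  have hZ1 : ContDiff ℝ ∞ (deriv Z) := (contDiff_infty_iff_deriv.1 hZ).2
  have hZ2 : ContDiff ℝ ∞ (deriv (deriv Z)) := (contDiff_infty_iff_deriv.1 hZ1).2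
  obtain ⟨B0, hB0⟩ := isCompact_Icc.exists_bound_of_continuousOn (s := Icc 0 ηc) hZ.continuous.continuousOn
  obtain ⟨B1, hB1⟩ := isCompact_Icc.exists_bound_of_continuousOn (s := Icc 0 ηc) hZ1.continuous.continuousOn
  obtain ⟨B2, hB2⟩ := isCompact_Icc.exists_bound_of_continuousOn (s := Icc 0 ηc) hZ2.continuous.continuousOn
  refine ⟨max 1 (max B0 (max B1 B2)), le_max_left _ _, fun η hη => ⟨?_, ?_, ?_⟩⟩
  · have h := hB0 η hη; rw [Real.norm_eq_abs] at h
    exact h.trans ((le_max_left _ _).trans (le_max_right _ _))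
  · have h := hB1 η hη; rw [Real.norm_eq_abs] at h
    exact h.trans (((le_max_left _ _).trans (le_max_right _ _)).trans (le_max_right _ _))
  · have h := hB2 η hη; rw [Real.norm_eq_abs] at h
    exact h.trans (((le_max_right _ _).trans (le_max_right _ _)).trans (le_max_right _ _))

/-- Mean value bound `|Z η - Z 0| ≤ Z_B η` on `[0, η_c]` from `|Z'| ≤ Z_B` there. [folklore] -/
theorem abs_Z_sub_Z_zero_le {Z : ℝ → ℝ} (hZ : ContDiff ℝ ∞ Z) {ηc ZB : ℝ}
    (hZB : ∀ η ∈ Icc 0 ηc, |deriv Z η| ≤ ZB) {η : ℝ} (hη : η ∈ Icc 0 ηc) : |Z η - Z 0| ≤ ZB * η := by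
  have hd : ∀ s ∈ Icc 0 ηc, HasDerivWithinAt Z (deriv Z s) (Icc 0 ηc) s := fun s _ =>
    ((hZ.differentiable (by simp)) s).hasDerivAt.hasDerivWithinAt
  have h := (convex_Icc 0 ηc).norm_image_sub_le_of_norm_hasDerivWithin_le hd
    (fun s hs => by rw [Real.norm_eq_abs]; exact hZB s hs) (left_mem_Icc.2 (hη.1.trans hη.2)) hη
  rw [Real.norm_eq_abs, Real.norm_eq_abs, sub_zero, abs_of_nonneg hη.1] at h
  exact h

end RealVariable

/-! ## §3 The level-0 stability estimate with constants uniform in `σ` -/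

section Level0

set_option maxHeartbeats 800000 in
/-- **Level-0 relative-energy stability between a `σ`-solution and an ideal-gas reference, with
constants uniform in the reduced diameter.** Under the equation-of-state hypothesis of
`hsEuler_localExistence`, for every state bound `M ≥ 1` and derivative bound `Λ ≥ 1` there are a
packing threshold `ηQ > 0` and constants `K₁, K₂, K₃ ≥ 0` — chosen BEFORE `σ` — such that for
every `0 < σ ≤ 1`, every classical hard-sphere Euler solution `(ρ, u, θ)` at reduced diameter `σ`
and every classical ideal-gas solution `(ρ₁, u₁, θ₁)` (`σ = 0`) on `[0, T) × 𝕋³` with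
`M⁻¹ ≤ ρ, θ, ρ₁, θ₁ ≤ M`, packing `ρσ³ ≤ ηQ` and first space derivatives bounded by `Λ`, the
`L²` distance obeys
`∫ (δρ² + ‖δu‖² + δθ²)(t) ≤ K₁ e^{K₂ t} (∫ (δρ² + ‖δu‖² + δθ²)(0) + K₃ (σ³ t)²)` for `t ∈ [0, T)`:
the symmetrised level-0 relative-energy balance `hsEuler_relativeEnergy_balance_two_eos`, its
remainder absorbed pointwise (`twoEos_rhs_alg_le`; the equation-of-state defects are `O(ρσ³)`),
and the Grönwall shell `HsEulerCalc.torus_energy_le_of_balance`.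
[cite: Dafermos2005, Thm 5.2.1] [cite: Kato1975, Thm III] -/
theorem hsEuler_twoEos_level0_stability :
    ∀ η₀ : ℝ, 0 < η₀ → ∀ F : ℝ → ℝ, AnalyticOnNhd ℝ F (Ioo (-η₀) η₀) →
      EqOn hsExcessFreeEnergy F (Ico 0 η₀) →
      ∀ M Λ : ℝ, 1 ≤ M → 1 ≤ Λ → ∃ ηQ K₁ K₂ K₃ : ℝ, 0 < ηQ ∧ 0 ≤ K₁ ∧ 0 ≤ K₂ ∧ 0 ≤ K₃ ∧
        ∀ σ : ℝ, 0 < σ → σ ≤ 1 → ∀ T : ℝ, 0 < T →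
        ∀ (ρ θ ρ₁ θ₁ : ℝ → T3 → ℝ) (u u₁ : ℝ → T3 → V3),
          IsHardSphereEulerSolution σ T ρ u θ → IsHardSphereEulerSolution 0 T ρ₁ u₁ θ₁ →
          (∀ t ∈ Ico 0 T, ∀ x, M⁻¹ ≤ ρ t x ∧ ρ t x ≤ M ∧ M⁻¹ ≤ θ t x ∧ θ t x ≤ M ∧
              M⁻¹ ≤ ρ₁ t x ∧ ρ₁ t x ≤ M ∧ M⁻¹ ≤ θ₁ t x ∧ θ₁ t x ≤ M ∧ ρ t x * σ ^ 3 ≤ ηQ ∧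
              ∀ i : Fin 3, |Torus.partialDeriv i (ρ t) x| ≤ Λ ∧ ‖Torus.partialDeriv i (u t) x‖ ≤ Λ ∧
                |Torus.partialDeriv i (θ t) x| ≤ Λ ∧ |Torus.partialDeriv i (ρ₁ t) x| ≤ Λ ∧
                ‖Torus.partialDeriv i (u₁ t) x‖ ≤ Λ ∧ |Torus.partialDeriv i (θ₁ t) x| ≤ Λ) →
          ∀ t ∈ Ico 0 T,
            ∫ x, ((ρ t x - ρ₁ t x) ^ 2 + ‖u t x - u₁ t x‖ ^ 2 + (θ t x - θ₁ t x) ^ 2) ≤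
              K₁ * Real.exp (K₂ * t) *
                ((∫ x, ((ρ 0 x - ρ₁ 0 x) ^ 2 + ‖u 0 x - u₁ 0 x‖ ^ 2 + (θ 0 x - θ₁ 0 x) ^ 2)) +
                  K₃ * (σ ^ 3 * t) ^ 2) := by
  intro η₀ hη₀ F hF hEq M Λ hM hΛ
  obtain ⟨Z, ηc, hZ, hZeq, hηc, hηc₀, hΓ⟩ := HsEulerUniform.exists_eos_family hη₀ hF hEq
  obtain ⟨ZB, hZB1, hZB⟩ := exists_bound_Z_derivs hZ ηc
  have hM0 : 0 < M := one_pos.trans_le hM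
  have hZB0 : 0 ≤ ZB := zero_le_one.trans hZB1
  -- `Z 0 = 1`
  have hZ0 : Z 0 = 1 := by
    have h := hZeq (show (0 : ℝ) ∈ Icc 0 (η₀ / 2) from ⟨le_rfl, by linarith only [hη₀]⟩)
    have h0 : hsCompressibility 0 = 1 := by simp [hsCompressibility]
    rw [← h, h0]
  -- the constants
  set P : ℝ := M + Λ + ZB with hP
  have hP1 : 1 ≤ P := by rw [hP]; linarith only [hM, hΛ, hZB1]
  have hP0 : 0 ≤ P := zero_le_one.trans hP1
  have hMP : M ≤ P := by rw [hP]; linarith only [hΛ, hZB1]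
  have hΛP : Λ ≤ P := by rw [hP]; linarith only [hM, hZB1]
  have hZBP : ZB ≤ P := by rw [hP]; linarith only [hM, hΛ]
  set Kq : ℝ := 100 * P ^ 6 with hKq
  set Kf : ℝ := 10 * P ^ 4 with hKf
  set Λ₀ : ℝ := 4 * M ^ 2 * Kq with hΛ₀
  set Cg : ℝ := 16 * M ^ 2 * Kf * ZB with hCg
  have hKq0 : 0 ≤ Kq := by positivity
  have hKf0 : 0 ≤ Kf := by positivity
  have hΛ₀0 : 0 ≤ Λ₀ := by positivity
  have hCg0 : 0 ≤ Cg := by positivity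
  refine ⟨ηc, 6 * M ^ 4 + 2 * M ^ 2 * Cg ^ 2, Λ₀, 1, hηc, by positivity, hΛ₀0, zero_le_one, ?_⟩
  intro σ hσ hσ1 T hT ρ θ ρ₁ θ₁ u u₁ hE hE₁ hb t ht
  have hU : UniqueDiffOn ℝ (Ico (0 : ℝ) T) := uniqueDiffOn_Ico 0 T
  have hτ0 : 0 < σ ^ 3 := by positivity
  have hτ1 : σ ^ 3 ≤ 1 := pow_le_one₀ hσ.le hσ1
  -- the rescaled law and its first two derivatives
  set ζ : ℝ → ℝ := fun s => Z (s * σ ^ 3) with hζdef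
  have hζs : ContDiff ℝ ∞ ζ := hZ.comp (contDiff_id.mul contDiff_const)
  have hζon : ContDiffOn ℝ ∞ ζ univ := hζs.contDiffOn
  have hZ1 : ContDiff ℝ ∞ (deriv Z) := (contDiff_infty_iff_deriv.1 hZ).2
  have hdζ : ∀ r, deriv ζ r = σ ^ 3 * deriv Z (r * σ ^ 3) := fun r => HsEulerUniform.deriv_rescale hZ _ _
  have hddζ : ∀ r, deriv (deriv ζ) r = σ ^ 3 * (σ ^ 3 * deriv (deriv Z) (r * σ ^ 3)) := by
    intro r
    have h1 : deriv ζ = fun r => σ ^ 3 * deriv Z (r * σ ^ 3) := funext hdζ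
    have hdiff : DifferentiableAt ℝ (fun r => deriv Z (r * σ ^ 3)) r :=
      ((hZ1.differentiable (by simp)).comp (differentiable_id.mul (differentiable_const _))) r
    rw [h1, deriv_const_mul _ hdiff, HsEulerUniform.deriv_rescale hZ1]
  -- the two pressure laws
  have hp : ∀ s ∈ Ico 0 T, ∀ y, hsPressure σ (ρ s y) (θ s y) = ρ s y * θ s y * ζ (ρ s y) := by
    intro s hs y
    obtain ⟨hρlo, -, -, -, -, -, -, -, hpack, -⟩ := hb s hs y
    have hρ0 : 0 ≤ ρ s y := (inv_pos.2 hM0).le.trans hρlo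
    exact HsEulerUniform.hsPressure_eq_of_eqOn hZeq (θ s y) ⟨by positivity, hpack.trans hηc₀⟩
  have hp₁ : ∀ s ∈ Ico 0 T, ∀ y, hsPressure 0 (ρ₁ s y) (θ₁ s y) = ρ₁ s y * θ₁ s y * (fun _ : ℝ => (1 : ℝ)) (ρ₁ s y) := by
    intro s _ y
    simp [hsPressure, hsCompressibility]
  -- the balance identity (two equations of state)
  have hid := fun s (hs : s ∈ Ico 0 T) (y : T3) =>
    hsEuler_relativeEnergy_balance_two_eos (ζ := ζ) (ζ₂ := fun _ : ℝ => (1 : ℝ)) (J := univ) (J₂ := univ)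
      hE hE₁ isOpen_univ isOpen_univ hζon contDiff_const.contDiffOn (fun _ _ _ => mem_univ _)
      (fun _ _ _ => mem_univ _) hp hp₁ hs y
  -- the energy density, the fluxes, the remainder
  set E : ℝ → T3 → ℝ := fun s y => 1 / 2 *
      (θ s y * (ζ (ρ s y) + ρ s y * deriv ζ (ρ s y)) / ρ s y * (ρ s y - ρ₁ s y) ^ 2 +
        ρ s y * ‖u s y - u₁ s y‖ ^ 2 + 3 / 2 * ρ s y / θ s y * (θ s y - θ₁ s y) ^ 2) with hEdef
  set Φf : Fin 3 → ℝ → T3 → ℝ := fun i s y =>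
      1 / 2 * (θ s y * (ζ (ρ s y) + ρ s y * deriv ζ (ρ s y)) / ρ s y * u s y i * (ρ s y - ρ₁ s y) ^ 2 +
            ρ s y * u s y i * ‖u s y - u₁ s y‖ ^ 2 +
            3 / 2 * ρ s y / θ s y * u s y i * (θ s y - θ₁ s y) ^ 2) +
          θ s y * (ζ (ρ s y) + ρ s y * deriv ζ (ρ s y)) * (ρ s y - ρ₁ s y) * (u s y i - u₁ s y i) +
          ρ s y * ζ (ρ s y) * (θ s y - θ₁ s y) * (u s y i - u₁ s y i) with hΦdef
  set R : ℝ → T3 → ℝ := fun s y =>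
      Torus.timeDerivWithin (Ico 0 T) E s y + (∑ i, Torus.partialDeriv i (Φf i s) y) - Λ₀ * E s y with hRdef
  -- smoothness
  have hα : Torus.IsSmoothSpaceTimeOn (Ico 0 T) (fun s y => ρ s y - ρ₁ s y) :=
    hE.smooth_density.sub hE₁.smooth_density
  have hw : Torus.IsSmoothSpaceTimeOn (Ico 0 T) (fun s y => u s y - u₁ s y) :=
    hE.smooth_velocity.sub hE₁.smooth_velocity
  have hβ : Torus.IsSmoothSpaceTimeOn (Ico 0 T) (fun s y => θ s y - θ₁ s y) :=
    hE.smooth_temperature.sub hE₁.smooth_temperature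
  have hEs : Torus.IsSmoothSpaceTimeOn (Ico 0 T) E :=
    isSmoothSpaceTimeOn_frozenEnergy hE isOpen_univ hζon (fun _ _ _ => mem_univ _) hα hw hβ
  have hΦs : ∀ i, Torus.IsSmoothSpaceTimeOn (Ico 0 T) (Φf i) := fun i => by
    have h := isSmoothSpaceTimeOn_frozenFlux hE isOpen_univ hζon (fun _ _ _ => mem_univ _) hα hw hβ i
    simpa only [PiLp.sub_apply] using h
  have hRs : Torus.IsSmoothSpaceTimeOn (Ico 0 T) R :=
    ((hEs.timeDerivWithin hU).add (Torus.IsSmoothSpaceTimeOn.sum fun i _ => (hΦs i).partialDeriv hU i)).sub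
      ((Torus.isSmoothSpaceTimeOn_const (Torus.isSmooth_const Λ₀) _).mul hEs)
  -- pointwise facts along the solutions
  have hpt : ∀ s ∈ Ico 0 T, ∀ y,
      (1 / (4 * M ^ 2) * ((ρ s y - ρ₁ s y) ^ 2 + ‖u s y - u₁ s y‖ ^ 2 + (θ s y - θ₁ s y) ^ 2) ≤ E s y) ∧
      (E s y ≤ 3 * M ^ 2 / 4 * ((ρ s y - ρ₁ s y) ^ 2 + ‖u s y - u₁ s y‖ ^ 2 + (θ s y - θ₁ s y) ^ 2)) ∧
      (R s y ≤ Kf * (2 * ZB * M * σ ^ 3) * (|θ s y - θ₁ s y| + ∑ j, |u s y j - u₁ s y j|)) := by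
    intro s hs y
    obtain ⟨hρlo, hρhi, hθlo, hθhi, hρ₁lo, hρ₁hi, hθ₁lo, hθ₁hi, hpack, hder⟩ := hb s hs y
    have hMi : 0 < M⁻¹ := inv_pos.2 hM0
    have hρ0 : 0 < ρ s y := hMi.trans_le hρlo
    have hθ0 : 0 < θ s y := hMi.trans_le hθlo
    have hρ₁0 : 0 < ρ₁ s y := hMi.trans_le hρ₁lo
    have hθ₁0 : 0 < θ₁ s y := hMi.trans_le hθ₁lo
    -- the packing and the equation of state at the point
    set η : ℝ := ρ s y * σ ^ 3 with hηdef
    have hη : η ∈ Icc 0 ηc := ⟨by positivity, hpack⟩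
    have hηM : η ≤ M * σ ^ 3 := mul_le_mul_of_nonneg_right hρhi hτ0.le
    have hMσ : M * σ ^ 3 ≤ M := mul_le_of_le_one_right hM0.le hτ1
    obtain ⟨⟨hZlo, hZhi⟩, ⟨hΓlo, hΓhi⟩⟩ := hΓ η (abs_le.2 ⟨by linarith only [hη.1, hηc], hη.2⟩)
    obtain ⟨hZBη, hZB1η, hZB2η⟩ := hZB η hη
    have hz : ζ (ρ s y) = Z η := rfl
    have hz1 : deriv ζ (ρ s y) = σ ^ 3 * deriv Z η := hdζ _
    have hz2 : deriv (deriv ζ) (ρ s y) = σ ^ 3 * (σ ^ 3 * deriv (deriv Z) η) := hddζ _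
    have hγ : ζ (ρ s y) + ρ s y * deriv ζ (ρ s y) = Z η + η * deriv Z η := by rw [hz, hz1, hηdef]; ring
    -- weights
    have hinvρ : (ρ s y)⁻¹ ≤ M := by have := inv_anti₀ hMi hρlo; rwa [inv_inv] at this
    have hinvθ : (θ s y)⁻¹ ≤ M := by have := inv_anti₀ hMi hθlo; rwa [inv_inv] at this
    have hinvρ₁ : (ρ₁ s y)⁻¹ ≤ M := by have := inv_anti₀ hMi hρ₁lo; rwa [inv_inv] at this
    have hM2 : 0 < 2 * M ^ 2 := by positivity
    have hiM : M⁻¹ * M = 1 := inv_mul_cancel₀ hM0.ne'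
    have hAlo : 1 / (2 * M ^ 2) ≤ θ s y * (ζ (ρ s y) + ρ s y * deriv ζ (ρ s y)) / ρ s y := by
      rw [hγ, le_div_iff₀ hρ0]
      have h2 : M⁻¹ * (1 / 2) ≤ θ s y * (Z η + η * deriv Z η) := mul_le_mul hθlo hΓlo (by norm_num) hθ0.le
      have h3 : 1 / (2 * M ^ 2) * ρ s y ≤ 1 / (2 * M ^ 2) * M := mul_le_mul_of_nonneg_left hρhi (by positivity)
      have h4 : 1 / (2 * M ^ 2) * M = M⁻¹ * (1 / 2) := by field_simp
      linarith only [h2, h3, h4]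
    have hAhi : θ s y * (ζ (ρ s y) + ρ s y * deriv ζ (ρ s y)) / ρ s y ≤ 3 * M ^ 2 / 2 := by
      rw [hγ, div_le_iff₀ hρ0]
      have h2 : θ s y * (Z η + η * deriv Z η) ≤ M * (3 / 2) := mul_le_mul hθhi hΓhi (by linarith) hM0.le
      have h3 : 3 * M ^ 2 / 2 * M⁻¹ ≤ 3 * M ^ 2 / 2 * ρ s y := mul_le_mul_of_nonneg_left hρlo (by positivity)
      have h4 : 3 * M ^ 2 / 2 * M⁻¹ = M * (3 / 2) := by field_simp
      linarith only [h2, h3, h4]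
    have hBlo : 1 / (2 * M ^ 2) ≤ 3 / 2 * ρ s y / θ s y := by
      rw [le_div_iff₀ hθ0]
      have h2 : 3 / 2 * M⁻¹ ≤ 3 / 2 * ρ s y := mul_le_mul_of_nonneg_left hρlo (by norm_num)
      have h3 : 1 / (2 * M ^ 2) * θ s y ≤ 1 / (2 * M ^ 2) * M := mul_le_mul_of_nonneg_left hθhi (by positivity)
      have h4 : 1 / (2 * M ^ 2) * M = M⁻¹ * (1 / 2) := by field_simp
      linarith only [h2, h3, h4, hMi]
    have hBhi : 3 / 2 * ρ s y / θ s y ≤ 3 * M ^ 2 / 2 := by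
      rw [div_le_iff₀ hθ0]
      have h2 : 3 / 2 * ρ s y ≤ 3 / 2 * M := mul_le_mul_of_nonneg_left hρhi (by norm_num)
      have h3 : 3 * M ^ 2 / 2 * M⁻¹ ≤ 3 * M ^ 2 / 2 * θ s y := mul_le_mul_of_nonneg_left hθlo (by positivity)
      have h4 : 3 * M ^ 2 / 2 * M⁻¹ = 3 / 2 * M := by field_simp
      linarith only [h2, h3, h4]
    have hρlo' : 1 / (2 * M ^ 2) ≤ ρ s y := by
      have h4 : 1 / (2 * M ^ 2) ≤ M⁻¹ := by
        rw [div_le_iff₀ hM2]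
        have : M⁻¹ * (2 * M ^ 2) = 2 * M := by field_simp
        rw [this]; linarith only [hM]
      exact h4.trans hρlo
    have hMM : M ≤ M ^ 2 := by simpa using pow_le_pow_right₀ hM one_le_two
    have hρhi' : ρ s y ≤ 3 * M ^ 2 / 2 := by linarith only [hρhi, hMM, hM]
    -- the quadratic size and the energy
    have hnormsq : ‖u s y - u₁ s y‖ ^ 2 = ∑ j, (u s y j - u₁ s y j) ^ 2 := by
      rw [EuclideanSpace.real_norm_sq_eq]
      rfl
    have hElo : 1 / (4 * M ^ 2) * ((ρ s y - ρ₁ s y) ^ 2 + ‖u s y - u₁ s y‖ ^ 2 + (θ s y - θ₁ s y) ^ 2) ≤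
        E s y := by
      have h := energy_alg_ge (al := ρ s y - ρ₁ s y) (be := θ s y - θ₁ s y) (n := ‖u s y - u₁ s y‖ ^ 2)
        hAlo hρlo' hBlo (sq_nonneg _)
      rw [min_self, min_self] at h
      have heq : 1 / (2 * M ^ 2) / 2 = 1 / (4 * M ^ 2) := by
        rw [div_div]; congr 1; ring
      rw [heq] at h
      have hE' : E s y = 1 / 2 * (θ s y * (ζ (ρ s y) + ρ s y * deriv ζ (ρ s y)) / ρ s y * (ρ s y - ρ₁ s y) ^ 2 +
          ρ s y * ‖u s y - u₁ s y‖ ^ 2 + 3 / 2 * ρ s y / θ s y * (θ s y - θ₁ s y) ^ 2) := rfl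
      rw [hE']
      linarith only [h]
    have hEhi : E s y ≤ 3 * M ^ 2 / 4 * ((ρ s y - ρ₁ s y) ^ 2 + ‖u s y - u₁ s y‖ ^ 2 + (θ s y - θ₁ s y) ^ 2) := by
      have hE' : E s y = 1 / 2 * (θ s y * (ζ (ρ s y) + ρ s y * deriv ζ (ρ s y)) / ρ s y * (ρ s y - ρ₁ s y) ^ 2 +
          ρ s y * ‖u s y - u₁ s y‖ ^ 2 + 3 / 2 * ρ s y / θ s y * (θ s y - θ₁ s y) ^ 2) := rfl
      rw [hE']
      have h1 := mul_le_mul_of_nonneg_right hAhi (sq_nonneg (ρ s y - ρ₁ s y))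
      have h2 := mul_le_mul_of_nonneg_right hρhi' (sq_nonneg ‖u s y - u₁ s y‖)
      have h3 := mul_le_mul_of_nonneg_right hBhi (sq_nonneg (θ s y - θ₁ s y))
      linarith only [h1, h2, h3]
    refine ⟨hElo, hEhi, ?_⟩
    -- atoms for the algebraic absorption
    have hth : |θ s y| ≤ P := by rw [abs_of_pos hθ0]; linarith only [hθhi, hMP]
    have hr : |ρ s y| ≤ P := by rw [abs_of_pos hρ0]; linarith only [hρhi, hMP]
    have hri : |(ρ s y)⁻¹| ≤ P := by rw [abs_of_pos (inv_pos.2 hρ0)]; linarith only [hinvρ, hMP]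
    have hthi : |(θ s y)⁻¹| ≤ P := by rw [abs_of_pos (inv_pos.2 hθ0)]; linarith only [hinvθ, hMP]
    have hth₁ : |θ₁ s y| ≤ P := by rw [abs_of_pos hθ₁0]; linarith only [hθ₁hi, hMP]
    have hr₁i : |(ρ₁ s y)⁻¹| ≤ P := by rw [abs_of_pos (inv_pos.2 hρ₁0)]; linarith only [hinvρ₁, hMP]
    have hzb : |ζ (ρ s y)| ≤ P := by rw [hz]; linarith only [hZBη, hZBP]
    have hz1b : |deriv ζ (ρ s y)| ≤ P := by
      rw [hz1, abs_mul, abs_of_pos hτ0]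
      have : σ ^ 3 * |deriv Z η| ≤ 1 * ZB := mul_le_mul hτ1 hZB1η (abs_nonneg _) zero_le_one
      linarith only [this, hZBP]
    have hz2b : |deriv (deriv ζ) (ρ s y)| ≤ P := by
      rw [hz2, abs_mul, abs_mul, abs_of_pos hτ0]
      have : σ ^ 3 * (σ ^ 3 * |deriv (deriv Z) η|) ≤ 1 * (1 * ZB) :=
        mul_le_mul hτ1 (mul_le_mul hτ1 hZB2η (abs_nonneg _) zero_le_one) (by positivity) zero_le_one
      linarith only [this, hZBP]
    -- first derivatives (components of vector derivatives are bounded by their norm)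
    have hus : Torus.IsSmooth (u s) := hE.smooth_velocity.isSmooth_slice hs
    have hu₁s : Torus.IsSmooth (u₁ s) := hE₁.smooth_velocity.isSmooth_slice hs
    have hdu : ∀ i j, |Torus.partialDeriv i (fun y => u s y j) y| ≤ P := by
      intro i j
      rw [Torus.partialDeriv_apply_coord (hus.isContDiff (by simp)) i y j]
      exact ((PiLp.norm_apply_le (Torus.partialDeriv i (u s) y) j).trans (hder i).2.1).trans hΛP
    have hdu₁ : ∀ i j, |Torus.partialDeriv i (fun y => u₁ s y j) y| ≤ P := by
      intro i j
      rw [Torus.partialDeriv_apply_coord (hu₁s.isContDiff (by simp)) i y j]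
      exact ((PiLp.norm_apply_le (Torus.partialDeriv i (u₁ s) y) j).trans (hder i).2.2.2.2.1).trans hΛP
    have hdρ : ∀ i, |Torus.partialDeriv i (ρ s) y| ≤ P := fun i => (hder i).1.trans hΛP
    have hdθ : ∀ i, |Torus.partialDeriv i (θ s) y| ≤ P := fun i => (hder i).2.2.1.trans hΛP
    have hdρ₁ : ∀ i, |Torus.partialDeriv i (ρ₁ s) y| ≤ P := fun i => (hder i).2.2.2.1.trans hΛP
    have hdθ₁ : ∀ i, |Torus.partialDeriv i (θ₁ s) y| ≤ P := fun i => (hder i).2.2.2.2.2.trans hΛP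
    -- the equation-of-state defects
    have hdz : |ζ (ρ s y) - 1| ≤ 2 * ZB * M * σ ^ 3 := by
      rw [hz, ← hZ0]
      have h := abs_Z_sub_Z_zero_le hZ (fun η' hη' => (hZB η' hη').2.1) hη
      have : ZB * η ≤ ZB * (M * σ ^ 3) := mul_le_mul_of_nonneg_left hηM hZB0
      have h0 : 0 ≤ ZB * (M * σ ^ 3) := by positivity
      linarith only [h, this, h0]
    have hdg : |ζ (ρ s y) + ρ s y * deriv ζ (ρ s y) - 1| ≤ 2 * ZB * M * σ ^ 3 := by
      rw [hγ]
      have h1 : |Z η - Z 0| ≤ ZB * η := abs_Z_sub_Z_zero_le hZ (fun η' hη' => (hZB η' hη').2.1) hη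
      rw [hZ0] at h1
      have h2 : |η * deriv Z η| ≤ η * ZB := by
        rw [abs_mul, abs_of_nonneg hη.1]; exact mul_le_mul_of_nonneg_left hZB1η hη.1
      have h3 : |Z η + η * deriv Z η - 1| ≤ |Z η - 1| + |η * deriv Z η| := by
        have : Z η + η * deriv Z η - 1 = (Z η - 1) + η * deriv Z η := by ring
        rw [this]; exact abs_add_le _ _
      have : ZB * η ≤ ZB * (M * σ ^ 3) := mul_le_mul_of_nonneg_left hηM hZB0
      linarith only [h1, h2, h3, this]
    -- the algebraic absorption of the remainder
    have halg := twoEos_rhs_alg_le (P := P) (D := 2 * ZB * M * σ ^ 3) (th := θ s y) (r := ρ s y)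
      (th₁ := θ₁ s y) (r₁ := ρ₁ s y) (z := ζ (ρ s y)) (z1 := deriv ζ (ρ s y)) (z2 := deriv (deriv ζ) (ρ s y))
      (z₂v := (fun _ : ℝ => (1 : ℝ)) (ρ₁ s y)) (z₂d := deriv (fun _ : ℝ => (1 : ℝ)) (ρ₁ s y))
      (du := fun i j => Torus.partialDeriv i (fun y => u s y j) y)
      (du₁ := fun i j => Torus.partialDeriv i (fun y => u₁ s y j) y)
      (dρ := fun i => Torus.partialDeriv i (ρ s) y) (dθ := fun i => Torus.partialDeriv i (θ s) y)
      (dρ₁ := fun i => Torus.partialDeriv i (ρ₁ s) y) (dθ₁ := fun i => Torus.partialDeriv i (θ₁ s) y)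
      (w := fun i => u s y i - u₁ s y i) hP1 hth hr hri hthi hth₁ hr₁i hρ0.ne' hρ₁0.ne' hzb hz1b hz2b
      hdu hdρ hdθ hdu₁ hdρ₁ hdθ₁ hdz hdg rfl (deriv_const _ _)
    have hkey : Torus.timeDerivWithin (Ico 0 T) E s y + ∑ i, Torus.partialDeriv i (Φf i s) y ≤
        Kq * ((ρ s y - ρ₁ s y) ^ 2 + (θ s y - θ₁ s y) ^ 2 + ∑ j, (u s y j - u₁ s y j) ^ 2) +
          Kf * (2 * ZB * M * σ ^ 3) * (|θ s y - θ₁ s y| + ∑ j, |u s y j - u₁ s y j|) :=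
      (hid s hs y).trans_le halg
    have hcoer : Kq * ((ρ s y - ρ₁ s y) ^ 2 + (θ s y - θ₁ s y) ^ 2 + ∑ j, (u s y j - u₁ s y j) ^ 2) ≤
        Λ₀ * E s y := by
      rw [← hnormsq]
      have h4MK : 0 ≤ 4 * M ^ 2 * Kq := by positivity
      have h := mul_le_mul_of_nonneg_left hElo h4MK
      have heq : 4 * M ^ 2 * Kq * (1 / (4 * M ^ 2) * ((ρ s y - ρ₁ s y) ^ 2 + ‖u s y - u₁ s y‖ ^ 2 +
          (θ s y - θ₁ s y) ^ 2)) = Kq * ((ρ s y - ρ₁ s y) ^ 2 + ‖u s y - u₁ s y‖ ^ 2 + (θ s y - θ₁ s y) ^ 2) := by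
        field_simp
      have hΛ₀' : Λ₀ * E s y = 4 * M ^ 2 * Kq * E s y := by rw [hΛ₀]
      linarith only [h, heq, hΛ₀']
    show Torus.timeDerivWithin (Ico 0 T) E s y + (∑ i, Torus.partialDeriv i (Φf i s) y) - Λ₀ * E s y ≤ _
    linarith only [hkey, hcoer]
  -- continuity of the slices
  have hEc : ∀ s ∈ Ico 0 T, Continuous (E s) := fun s hs => (hEs.isSmooth_slice hs).continuous
  have hq_def : ∀ s (y : T3), 0 ≤ (ρ s y - ρ₁ s y) ^ 2 + ‖u s y - u₁ s y‖ ^ 2 + (θ s y - θ₁ s y) ^ 2 :=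
    fun s y => by positivity
  have hqc : ∀ s ∈ Ico 0 T, Continuous fun y => (ρ s y - ρ₁ s y) ^ 2 + ‖u s y - u₁ s y‖ ^ 2 + (θ s y - θ₁ s y) ^ 2 :=
    fun s hs => (((hα.isSmooth_slice hs).continuous.pow 2).add (((hw.isSmooth_slice hs).continuous.norm).pow 2)).add
      ((hβ.isSmooth_slice hs).continuous.pow 2)
  have hE0 : ∀ s ∈ Ico 0 T, ∀ y, 0 ≤ E s y := fun s hs y =>
    le_trans (mul_nonneg (by positivity) (hq_def s y)) (hpt s hs y).1
  -- `∫ q ≤ 4M² ∫ E` and `∫ E ≤ (3M²/4) ∫ q` on every slice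
  have hqE : ∀ s ∈ Ico 0 T, ∫ y, ((ρ s y - ρ₁ s y) ^ 2 + ‖u s y - u₁ s y‖ ^ 2 + (θ s y - θ₁ s y) ^ 2) ≤
      4 * M ^ 2 * ∫ y, E s y := by
    intro s hs
    have h := integral_mono (((hqc s hs).integrable_unitAddTorus).const_mul (1 / (4 * M ^ 2)))
      ((hEc s hs).integrable_unitAddTorus) (fun y => (hpt s hs y).1)
    rw [integral_const_mul (1 / (4 * M ^ 2))
      (fun y => (ρ s y - ρ₁ s y) ^ 2 + ‖u s y - u₁ s y‖ ^ 2 + (θ s y - θ₁ s y) ^ 2)] at h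
    have h4 : (0 : ℝ) < 4 * M ^ 2 := by positivity
    have := mul_le_mul_of_nonneg_left h h4.le
    rwa [← mul_assoc, mul_one_div_cancel h4.ne', one_mul] at this
  have hEq' : ∀ s ∈ Ico 0 T, ∫ y, E s y ≤
      3 * M ^ 2 / 4 * ∫ y, ((ρ s y - ρ₁ s y) ^ 2 + ‖u s y - u₁ s y‖ ^ 2 + (θ s y - θ₁ s y) ^ 2) := by
    intro s hs
    have h := integral_mono ((hEc s hs).integrable_unitAddTorus)
      (((hqc s hs).integrable_unitAddTorus).const_mul (3 * M ^ 2 / 4)) (fun y => (hpt s hs y).2.1)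
    rwa [integral_const_mul (3 * M ^ 2 / 4)
      (fun y => (ρ s y - ρ₁ s y) ^ 2 + ‖u s y - u₁ s y‖ ^ 2 + (θ s y - θ₁ s y) ^ 2)] at h
  -- the forcing bound `∫ R ≤ Cg σ³ √(∫ E)`
  have hforce : ∀ s ∈ Ico 0 T, ∫ y, R s y ≤ Cg * σ ^ 3 * Real.sqrt (∫ y, E s y) := by
    intro s hs
    have hRc : Continuous (R s) := (hRs.isSmooth_slice hs).continuous
    have hβc : Continuous (fun y => θ s y - θ₁ s y) := (hβ.isSmooth_slice hs).continuous
    have hwc : Continuous (fun y => u s y - u₁ s y) := (hw.isSmooth_slice hs).continuous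
    have hwjc : ∀ j, Continuous (fun y => u s y j - u₁ s y j) := fun j => by
      have h : Continuous (fun y => (u s y - u₁ s y) j) := (EuclideanSpace.proj j).continuous.comp hwc
      simpa only [PiLp.sub_apply] using h
    set D : ℝ := 2 * ZB * M * σ ^ 3 with hD
    have hD0 : 0 ≤ D := by positivity
    have hbc : Continuous fun y => Kf * D * (|θ s y - θ₁ s y| + ∑ j, |u s y j - u₁ s y j|) :=
      continuous_const.mul (hβc.abs.add (continuous_finsetSum _ fun j _ => (hwjc j).abs))
    have h1 : ∫ y, R s y ≤ ∫ y, Kf * D * (|θ s y - θ₁ s y| + ∑ j, |u s y j - u₁ s y j|) :=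
      integral_mono hRc.integrable_unitAddTorus hbc.integrable_unitAddTorus fun y => (hpt s hs y).2.2
    -- `∫ |g| ≤ √(∫ g²) ≤ 2M √(∫ E)` for the components of the difference
    have hsqE : Real.sqrt (∫ y, ((ρ s y - ρ₁ s y) ^ 2 + ‖u s y - u₁ s y‖ ^ 2 + (θ s y - θ₁ s y) ^ 2)) ≤
        2 * M * Real.sqrt (∫ y, E s y) := by
      have h := Real.sqrt_le_sqrt (hqE s hs)
      rw [Real.sqrt_mul (by positivity), show Real.sqrt (4 * M ^ 2) = 2 * M by
        rw [show (4 : ℝ) * M ^ 2 = (2 * M) ^ 2 by ring, Real.sqrt_sq (by positivity)]] at h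
      exact h
    have habs : ∀ g : T3 → ℝ, Continuous g →
        (∀ y, g y ^ 2 ≤ (ρ s y - ρ₁ s y) ^ 2 + ‖u s y - u₁ s y‖ ^ 2 + (θ s y - θ₁ s y) ^ 2) →
        ∫ y, |g y| ≤ 2 * M * Real.sqrt (∫ y, E s y) := by
      intro g hg hgq
      have hcs := Torus.integral_mul_le_sqrt_mul_sqrt (f := fun y => |g y|) (g := fun _ => (1 : ℝ)) hg.abs
        continuous_const
      simp only [mul_one, one_pow, integral_const, probReal_univ, smul_eq_mul, Real.sqrt_one, sq_abs] at hcs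
      have hmono : ∫ y, g y ^ 2 ≤ ∫ y, ((ρ s y - ρ₁ s y) ^ 2 + ‖u s y - u₁ s y‖ ^ 2 + (θ s y - θ₁ s y) ^ 2) :=
        integral_mono (hg.pow 2).integrable_unitAddTorus (hqc s hs).integrable_unitAddTorus hgq
      exact hcs.trans ((Real.sqrt_le_sqrt hmono).trans hsqE)
    have hβint : ∫ y, |θ s y - θ₁ s y| ≤ 2 * M * Real.sqrt (∫ y, E s y) :=
      habs _ hβc fun y => by linarith only [sq_nonneg (ρ s y - ρ₁ s y), sq_nonneg ‖u s y - u₁ s y‖]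
    have hwint : ∀ j, ∫ y, |u s y j - u₁ s y j| ≤ 2 * M * Real.sqrt (∫ y, E s y) := fun j =>
      habs _ (hwjc j) fun y => by
        have h0 : (u s y - u₁ s y) j ^ 2 ≤ ‖u s y - u₁ s y‖ ^ 2 := by
          rw [EuclideanSpace.real_norm_sq_eq]
          exact Finset.single_le_sum (f := fun i => (u s y - u₁ s y) i ^ 2) (fun i _ => sq_nonneg _)
            (Finset.mem_univ j)
        have h1 : (u s y j - u₁ s y j) ^ 2 ≤ ‖u s y - u₁ s y‖ ^ 2 := by simpa only [PiLp.sub_apply] using h0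
        linarith only [h1, sq_nonneg (ρ s y - ρ₁ s y), sq_nonneg (θ s y - θ₁ s y)]
    have h2 : ∫ y, Kf * D * (|θ s y - θ₁ s y| + ∑ j, |u s y j - u₁ s y j|) =
        Kf * D * ((∫ y, |θ s y - θ₁ s y|) + ∑ j, ∫ y, |u s y j - u₁ s y j|) := by
      rw [integral_const_mul (Kf * D), integral_add hβc.abs.integrable_unitAddTorus
        (continuous_finsetSum _ fun j _ => (hwjc j).abs).integrable_unitAddTorus,
        integral_finsetSum _ fun j _ => (hwjc j).abs.integrable_unitAddTorus]
    have h3 : (∫ y, |θ s y - θ₁ s y|) + ∑ j, ∫ y, |u s y j - u₁ s y j| ≤ 4 * (2 * M * Real.sqrt (∫ y, E s y)) := by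
      have hs3 : ∑ j, ∫ y, |u s y j - u₁ s y j| ≤ ∑ _j : Fin 3, 2 * M * Real.sqrt (∫ y, E s y) :=
        Finset.sum_le_sum fun j _ => hwint j
      simp only [Finset.sum_const, Finset.card_univ, Fintype.card_fin, nsmul_eq_mul, Nat.cast_ofNat] at hs3
      linarith only [hβint, hs3]
    have hKD : 0 ≤ Kf * D := mul_nonneg hKf0 hD0
    calc ∫ y, R s y ≤ Kf * D * ((∫ y, |θ s y - θ₁ s y|) + ∑ j, ∫ y, |u s y j - u₁ s y j|) := h1.trans_eq h2
      _ ≤ Kf * D * (4 * (2 * M * Real.sqrt (∫ y, E s y))) := mul_le_mul_of_nonneg_left h3 hKD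
      _ = Cg * σ ^ 3 * Real.sqrt (∫ y, E s y) := by rw [hD, hCg]; ring
  -- the Grönwall shell
  have hshell := torus_energy_le_of_balance (e := E) (r := R) (Φ := Φf) (Λ := fun _ => Λ₀)
    (G := fun _ => Cg * σ ^ 3) hEs hRs hΦs hE0 continuousOn_const continuousOn_const (fun _ _ => hΛ₀0)
    (fun _ _ => by positivity) (fun s _ y => le_of_eq (by simp only [hRdef]; ring)) hforce t ht
  rw [intervalIntegral.integral_const, intervalIntegral.integral_const, sub_zero, smul_eq_mul, smul_eq_mul] at hshell
  -- the final arithmetic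
  have hEt0 : 0 ≤ ∫ y, E t y := integral_nonneg fun y => hE0 t ht y
  have h0T : (0 : ℝ) ∈ Ico 0 T := ⟨le_rfl, hT⟩
  have hE00 : 0 ≤ ∫ y, E 0 y := integral_nonneg fun y => hE0 0 h0T y
  have hX00 : 0 ≤ ∫ y, ((ρ 0 y - ρ₁ 0 y) ^ 2 + ‖u 0 y - u₁ 0 y‖ ^ 2 + (θ 0 y - θ₁ 0 y) ^ 2) :=
    integral_nonneg fun y => hq_def 0 y
  have hrhs0 : 0 ≤ Real.sqrt (∫ y, E 0 y) + t * (Cg * σ ^ 3) / 2 := by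
    have : 0 ≤ t := ht.1
    positivity
  have hsq : ∫ y, E t y ≤ Real.exp (Λ₀ * t) * (2 * (∫ y, E 0 y) + 2 * (t * (Cg * σ ^ 3) / 2) ^ 2) := by
    have h1 : ∫ y, E t y = Real.sqrt (∫ y, E t y) ^ 2 := (Real.sq_sqrt hEt0).symm
    have h2 : Real.sqrt (∫ y, E t y) ^ 2 ≤
        (Real.exp (t * Λ₀ / 2) * (Real.sqrt (∫ y, E 0 y) + t * (Cg * σ ^ 3) / 2)) ^ 2 :=
      pow_le_pow_left₀ (Real.sqrt_nonneg _) hshell 2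
    have hexp : Real.exp (t * Λ₀ / 2) ^ 2 = Real.exp (Λ₀ * t) := by
      rw [sq, ← Real.exp_add]; ring_nf
    have h3 : (Real.sqrt (∫ y, E 0 y) + t * (Cg * σ ^ 3) / 2) ^ 2 ≤
        2 * (∫ y, E 0 y) + 2 * (t * (Cg * σ ^ 3) / 2) ^ 2 := by
      have hss : Real.sqrt (∫ y, E 0 y) ^ 2 = ∫ y, E 0 y := Real.sq_sqrt hE00
      have key : (Real.sqrt (∫ y, E 0 y) + t * (Cg * σ ^ 3) / 2) ^ 2 =
          2 * Real.sqrt (∫ y, E 0 y) ^ 2 + 2 * (t * (Cg * σ ^ 3) / 2) ^ 2 -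
            (Real.sqrt (∫ y, E 0 y) - t * (Cg * σ ^ 3) / 2) ^ 2 := by ring
      rw [key]
      linarith only [sq_nonneg (Real.sqrt (∫ y, E 0 y) - t * (Cg * σ ^ 3) / 2), hss]
    rw [h1]
    refine h2.trans ?_
    rw [mul_pow, hexp]
    exact mul_le_mul_of_nonneg_left h3 (Real.exp_pos _).le
  have hexp0 : 0 ≤ Real.exp (Λ₀ * t) := (Real.exp_pos _).le
  have hA := hqE t ht
  have hB := hEq' 0 h0T
  have hst2 : 0 ≤ (σ ^ 3 * t) ^ 2 := sq_nonneg _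
  have hM4 : 0 ≤ M ^ 4 := by positivity
  have hM2 : 0 ≤ M ^ 2 := by positivity
  -- chain: ∫q(t) ≤ 4M² ∫E(t) ≤ 4M² e^{Λ₀t}(2∫E(0) + 2(tCgσ³/2)²) ≤ e^{Λ₀t}(6M⁴ ∫q(0) + 2M²Cg²(σ³t)²)
  have hC1 : 4 * M ^ 2 * (Real.exp (Λ₀ * t) * (2 * (∫ y, E 0 y) + 2 * (t * (Cg * σ ^ 3) / 2) ^ 2)) ≤
      Real.exp (Λ₀ * t) * (6 * M ^ 4 * (∫ y, ((ρ 0 y - ρ₁ 0 y) ^ 2 + ‖u 0 y - u₁ 0 y‖ ^ 2 + (θ 0 y - θ₁ 0 y) ^ 2)) +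
        2 * M ^ 2 * Cg ^ 2 * (σ ^ 3 * t) ^ 2) := by
    have heq : 4 * M ^ 2 * (Real.exp (Λ₀ * t) * (2 * (∫ y, E 0 y) + 2 * (t * (Cg * σ ^ 3) / 2) ^ 2)) =
        Real.exp (Λ₀ * t) * (8 * M ^ 2 * (∫ y, E 0 y) + 2 * M ^ 2 * Cg ^ 2 * (σ ^ 3 * t) ^ 2) := by ring
    rw [heq]
    refine mul_le_mul_of_nonneg_left ?_ hexp0
    have hBM := mul_le_mul_of_nonneg_left hB hM2
    linarith only [hBM]
  have hC2 : Real.exp (Λ₀ * t) * (6 * M ^ 4 * (∫ y, ((ρ 0 y - ρ₁ 0 y) ^ 2 + ‖u 0 y - u₁ 0 y‖ ^ 2 + (θ 0 y - θ₁ 0 y) ^ 2)) +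
        2 * M ^ 2 * Cg ^ 2 * (σ ^ 3 * t) ^ 2) ≤
      (6 * M ^ 4 + 2 * M ^ 2 * Cg ^ 2) * Real.exp (Λ₀ * t) *
        ((∫ y, ((ρ 0 y - ρ₁ 0 y) ^ 2 + ‖u 0 y - u₁ 0 y‖ ^ 2 + (θ 0 y - θ₁ 0 y) ^ 2)) + 1 * (σ ^ 3 * t) ^ 2) := by
    have hK : 6 * M ^ 4 * (∫ y, ((ρ 0 y - ρ₁ 0 y) ^ 2 + ‖u 0 y - u₁ 0 y‖ ^ 2 + (θ 0 y - θ₁ 0 y) ^ 2)) +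
        2 * M ^ 2 * Cg ^ 2 * (σ ^ 3 * t) ^ 2 ≤
        (6 * M ^ 4 + 2 * M ^ 2 * Cg ^ 2) *
          ((∫ y, ((ρ 0 y - ρ₁ 0 y) ^ 2 + ‖u 0 y - u₁ 0 y‖ ^ 2 + (θ 0 y - θ₁ 0 y) ^ 2)) + 1 * (σ ^ 3 * t) ^ 2) := by
      have hx := mul_nonneg (mul_nonneg hM2 (sq_nonneg Cg)) hX00
      have hy := mul_nonneg hM4 hst2
      linarith only [hx, hy]
    have := mul_le_mul_of_nonneg_left hK hexp0
    linarith only [this]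
  calc ∫ y, ((ρ t y - ρ₁ t y) ^ 2 + ‖u t y - u₁ t y‖ ^ 2 + (θ t y - θ₁ t y) ^ 2) ≤ 4 * M ^ 2 * ∫ y, E t y := hA
    _ ≤ 4 * M ^ 2 * (Real.exp (Λ₀ * t) * (2 * (∫ y, E 0 y) + 2 * (t * (Cg * σ ^ 3) / 2) ^ 2)) :=
        mul_le_mul_of_nonneg_left hsq (by positivity)
    _ ≤ _ := hC1
    _ ≤ _ := hC2

end Level0

end HsEulerStability

end Literature.MathematicalPhysics.KineticTheory

end
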